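import Summits.RiemannHypothesis.RiemannHypothesis.Theorems.GroundBartaEvenWinsBeyondArchDeflationWindowGlue
import Literature.NumberTheory.LFunctions.WeilArchDensityPanelCheck
import Literature.NumberTheory.LFunctions.WeilTwoPrimeCellsMP
import HarnessLib

/-!
# RiemannHypothesis / GroundBarta — rung 4 (`EvenWinsBeyondArch`, stmt-RiemannHypothesis-18807 / 18085):
# the deflated Temple L-side, XIX a — panel form of the explicit residual, decided window flags, switch brackets

Helper file (`--supports stmt-RiemannHypothesis-18807`), RH-free, Mathlib + landed tree files only, no facts.  Prover B,
speedrun unit `sr-gb-rung-b` (gen 4).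

The certificate-facing glue between the explicit real residual `dt_windowResidual` (file XVIII c) and the per-panel rules
(files XVIII a/b):
* `dt_polyLinComb`, `dt_killPoly`, `dt_eval_killPoly` — the killing + projection part `−M̃ g_i − Σ_l W̃_il g_l` as ONE polynomial
  (rational `M̃`, `W̃`), so that the residual on a panel is literally the function the kernel Taylor models enclose
  (`dt_windowResidual_panelForm`);
* `dt_panelCentre_cast`, `dt_halfWidth_cast` — `(2j+1)·(c/(2m))` over `ℝ` versus `panelCentre (c/(2m)) j` over `ℚ`;
* `dt_decideMem` / `dt_decideMem_sound` (endpoints via `MI_mem_bounds`) — window membership of `y₀ + ρ + s` for ALL `|ρ| ≤ h` decided by rational comparisons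
  against an enclosure `s ∈ [s⁻, s⁺]`; `dt_flagMinus_sound` / `dt_flagPlus_sound` — the same for `y₀ + ρ ∓ L` from a kernel
  enclosure `MI.mem S L I` (the flags of the bulk and edge panels);
* `dt_switchPlus_*` / `dt_switchMinus_*` — on a panel containing the switch point `β` of `y + L ≤ c` (resp. `−c ≤ y − L`) the
  membership is constant on `(-h, β)` and on `(β, h)`, and `β` is bracketed by rationals read off the enclosure of `L`
  (the data of `dt_panelBound_split`).

References: E. Bombieri, Rend. Mat. Acc. Lincei (9) 11 (2000) Thm 2 [Bombieri2000Weil].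
-/

set_option linter.dupNamespace false

noncomputable section

open MeasureTheory Set Filter Finset
open scoped Topology BigOperators

namespace Summit.RiemannHypothesis.RiemannHypothesis.Theorems.EvenWinsBeyondArch

open Literature.NumberTheory.LFunctions
open Literature.Analysis.ValidatedNumerics.ExpPoly Literature.Analysis.ValidatedNumerics.NumericsMP

/-! ## The killing + projection polynomial -/

/-- `Σ_r a_r · p_r` as one polynomial. -/
def dt_polyLinComb : List (ℚ × Poly) → Poly
  | [] => []
  | ap :: rest => Poly.add (Poly.smul ap.1 ap.2) (dt_polyLinComb rest)

/-- `eval (Σ_r a_r p_r) y = Σ_r a_r · eval p_r y`. -/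
theorem dt_eval_polyLinComb : ∀ (L : List (ℚ × Poly)) (y : ℝ),
    Poly.eval (dt_polyLinComb L) y = (L.map fun ap ↦ (ap.1 : ℝ) * Poly.eval ap.2 y).sum
  | [], y => by simp [dt_polyLinComb]
  | ap :: rest, y => by
      rw [dt_polyLinComb, Poly.eval_add, Poly.eval_smul, dt_eval_polyLinComb rest y, List.map_cons, List.sum_cons]

/-- The killing + projection polynomial of the `i`-th vector: `−M̃ g_i − Σ_l W̃_il g_l` (`W̃_i·` given as the row `Wrow`). -/
def dt_killPoly {k : ℕ} (gp : Fin k → Poly) (Mt : ℚ) (Wrow : Fin k → ℚ) (i : Fin k) : Poly :=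
  dt_polyLinComb ((-Mt, gp i) :: List.ofFn fun l ↦ (-Wrow l, gp l))

/-- `eval (dt_killPoly gp M̃ W̃ᵢ i) y = −M̃ g_i(y) − Σ_l W̃_il g_l(y)`. -/
theorem dt_eval_killPoly {k : ℕ} (gp : Fin k → Poly) (Mt : ℚ) (Wrow : Fin k → ℚ) (i : Fin k) (y : ℝ) :
    Poly.eval (dt_killPoly gp Mt Wrow i) y =
      -(Mt : ℝ) * Poly.eval (gp i) y - ∑ l, (Wrow l : ℝ) * Poly.eval (gp l) y := by
  rw [dt_killPoly, dt_eval_polyLinComb, List.map_cons, List.sum_cons, List.map_ofFn, List.sum_ofFn]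
  simp only [Function.comp_def, Rat.cast_neg, neg_mul, Finset.sum_neg_distrib]
  ring

/-! ## Panel centres and half-widths over `ℝ` -/

/-- `panelCentre (c/(2m)) j = (2j+1)·(c/(2m))` over `ℝ`. -/
theorem dt_panelCentre_cast (c : ℚ) (m j : ℕ) :
    ((panelCentre (c / (2 * m)) j : ℚ) : ℝ) = (2 * j + 1) * ((c : ℝ) / (2 * m)) := by
  simp only [panelCentre]
  push_cast
  ring

/-- `((c/(2m) : ℚ) : ℝ) = c/(2m)` over `ℝ`. -/
theorem dt_halfWidth_cast (c : ℚ) (m : ℕ) : ((c / (2 * m) : ℚ) : ℝ) = (c : ℝ) / (2 * m) := by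
  push_cast
  ring

/-! ## The explicit residual on a panel is the function the kernel models enclose -/

section PanelForm

variable {k : ℕ}

/-- **Panel form.**  With rational stand-ins `M̃`, `W̃` the explicit residual `dt_windowResidual` of the `i`-th vector, evaluated
at `y = y_j + ρ`, is literally the function of `dt_panelBound_bulk` / `_split` / `_edge` with `gp := gp i` and
`pk := dt_killPoly gp M̃ W̃ᵢ i`. [cite: Bombieri2000Weil, Thm 2] -/
theorem dt_windowResidual_panelForm (c : ℚ) (gp : Fin k → Poly) (w1 L1 w2 L2 w3 L3 : ℝ) (Mt : ℚ)
    (Wt : Fin k → Fin k → ℚ) (i : Fin k) (y0 : ℚ) (ρ : ℝ) :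
    dt_windowResidual (c : ℝ) gp w1 L1 w2 L2 w3 L3 (Mt : ℝ) (fun a l ↦ (Wt a l : ℝ)) i ((y0 : ℝ) + ρ) =
      (2 * (∫ x in (-(c : ℝ))..c, Poly.eval (gp i) x * Real.cosh (x / 2)) * Real.cosh (((y0 : ℝ) + ρ) / 2) -
        2 * (∫ x in (-(c : ℝ))..c, Poly.eval (gp i) x * Real.sinh (x / 2)) * Real.sinh (((y0 : ℝ) + ρ) / 2)) +
      (w1 * (2 * Poly.eval (gp i) ((y0 : ℝ) + ρ) -
          (Icc (-(c : ℝ)) c).indicator (fun x ↦ Poly.eval (gp i) x) (((y0 : ℝ) + ρ) - L1) -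
          (Icc (-(c : ℝ)) c).indicator (fun x ↦ Poly.eval (gp i) x) (((y0 : ℝ) + ρ) + L1)) +
        w2 * (2 * Poly.eval (gp i) ((y0 : ℝ) + ρ) -
          (Icc (-(c : ℝ)) c).indicator (fun x ↦ Poly.eval (gp i) x) (((y0 : ℝ) + ρ) - L2) -
          (Icc (-(c : ℝ)) c).indicator (fun x ↦ Poly.eval (gp i) x) (((y0 : ℝ) + ρ) + L2)) +
        w3 * (2 * Poly.eval (gp i) ((y0 : ℝ) + ρ) -
          (Icc (-(c : ℝ)) c).indicator (fun x ↦ Poly.eval (gp i) x) (((y0 : ℝ) + ρ) - L3) -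
          (Icc (-(c : ℝ)) c).indicator (fun x ↦ Poly.eval (gp i) x) (((y0 : ℝ) + ρ) + L3))) +
      ((∫ t in Ioc 0 ((c : ℝ) - ((y0 : ℝ) + ρ)),
          weilArchDensityG t * ((2 * Poly.eval (gp i) ((y0 : ℝ) + ρ) -
            Poly.eval (gp i) ((y0 : ℝ) + ρ - t) - Poly.eval (gp i) ((y0 : ℝ) + ρ + t)) / t)) +
        ∫ t in Ioc ((c : ℝ) - ((y0 : ℝ) + ρ)) ((c : ℝ) + ((y0 : ℝ) + ρ)),
          weilArchDensityG t * ((Poly.eval (gp i) ((y0 : ℝ) + ρ) - Poly.eval (gp i) ((y0 : ℝ) + ρ - t)) / t)) +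
      Poly.eval (gp i) ((y0 : ℝ) + ρ) *
        (weilArchTail ((c : ℝ) - ((y0 : ℝ) + ρ)) + weilArchTail ((c : ℝ) + ((y0 : ℝ) + ρ))) +
      Poly.eval (dt_killPoly gp Mt (Wt i) i) ((y0 : ℝ) + ρ) := by
  rw [dt_windowResidual, dt_eval_killPoly]
  ring

end PanelForm

/-! ## Window membership on a whole panel, decided over `ℚ` -/

/-- Decide, by rational comparisons, whether `y₀ + ρ + s ∈ [−c, c]` holds for ALL `|ρ| ≤ h` (`some true`), fails for all of
them (`some false`), or cannot be decided from the enclosure `s ∈ [s⁻, s⁺]` (`none`). -/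
def dt_decideMem (c h y0 slo shi : ℚ) : Option Bool :=
  if -c ≤ y0 - h + slo ∧ y0 + h + shi ≤ c then some true
  else if y0 + h + shi < -c ∨ c < y0 - h + slo then some false else none

/-- **Soundness of `dt_decideMem`.** -/
theorem dt_decideMem_sound {c h y0 slo shi : ℚ} {b : Bool} (hb : dt_decideMem c h y0 slo shi = some b) {s : ℝ}
    (hs1 : (slo : ℝ) ≤ s) (hs2 : s ≤ shi) {ρ : ℝ} (hρ : |ρ| ≤ h) :
    (b = true ↔ (y0 : ℝ) + ρ + s ∈ Icc (-(c : ℝ)) c) := by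
  unfold dt_decideMem at hb
  split_ifs at hb with h1 h2
  · have hb' : b = true := by simpa using hb.symm
    refine ⟨fun _ ↦ ?_, fun _ ↦ hb'⟩
    have e1 : -(c : ℝ) ≤ (y0 : ℝ) - h + slo := by exact_mod_cast h1.1
    have e2 : (y0 : ℝ) + h + shi ≤ c := by exact_mod_cast h1.2
    exact dt_mem_window_of_bounds hs1 hs2 e1 e2 hρ
  · have hb' : b = false := by simpa using hb.symm
    refine ⟨fun h' ↦ by simp [hb'] at h', fun hm ↦ ?_⟩
    exfalso
    rcases h2 with hlt | hgt
    · have e : (y0 : ℝ) + h + shi < -c := by exact_mod_cast hlt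
      exact dt_not_mem_window_of_lt hs2 e hρ hm
    · have e : (c : ℝ) < (y0 : ℝ) - h + slo := by exact_mod_cast hgt
      exact dt_not_mem_window_of_gt hs1 e hρ hm

/-- The flag of the shifted copy `y − L`, from the enclosure `I ∋ L`. -/
def dt_flagMinus (S : ℕ) (c h y0 : ℚ) (I : MI) : Option Bool :=
  dt_decideMem c h y0 (-((I.hi : ℚ) / S)) (-((I.lo : ℚ) / S))

/-- The flag of the shifted copy `y + L`, from the enclosure `I ∋ L`. -/
def dt_flagPlus (S : ℕ) (c h y0 : ℚ) (I : MI) : Option Bool :=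
  dt_decideMem c h y0 ((I.lo : ℚ) / S) ((I.hi : ℚ) / S)

/-- **Soundness of `dt_flagMinus`**: the decided flag is the membership of `y₀ + ρ − L` for all `|ρ| ≤ h`. -/
theorem dt_flagMinus_sound {S : ℕ} (hS : 0 < S) {c h y0 : ℚ} {I : MI} {b : Bool} (hb : dt_flagMinus S c h y0 I = some b)
    {L : ℝ} (hL : MI.mem S L I) {ρ : ℝ} (hρ : |ρ| ≤ h) :
    (b = true ↔ ((y0 : ℝ) + ρ) - L ∈ Icc (-(c : ℝ)) c) := by
  obtain ⟨h1, h2⟩ := MI_mem_bounds hS hL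
  push_cast at h1 h2
  rw [sub_eq_add_neg]
  exact dt_decideMem_sound hb (s := -L) (by push_cast; linarith) (by push_cast; linarith) hρ

/-- **Soundness of `dt_flagPlus`**: the decided flag is the membership of `y₀ + ρ + L` for all `|ρ| ≤ h`. -/
theorem dt_flagPlus_sound {S : ℕ} (hS : 0 < S) {c h y0 : ℚ} {I : MI} {b : Bool} (hb : dt_flagPlus S c h y0 I = some b)
    {L : ℝ} (hL : MI.mem S L I) {ρ : ℝ} (hρ : |ρ| ≤ h) :
    (b = true ↔ ((y0 : ℝ) + ρ) + L ∈ Icc (-(c : ℝ)) c) := by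
  obtain ⟨h1, h2⟩ := MI_mem_bounds hS hL
  exact dt_decideMem_sound hb h1 h2 hρ

/-! ## Panels containing a switch point -/

/-- The rational bracket `[c − I⁺/S − y₀, c − I⁻/S − y₀]` of the switch point `β = c − L − y₀` of the copy `y + L`, and the side
condition `−c ≤ y₀ − h + I⁻/S` (the copy never leaves the window on the left). -/
def dt_switchPlusCheck (S : ℕ) (c h y0 : ℚ) (I : MI) (bm bp : ℚ) : Bool :=
  decide (bm = c - (I.hi : ℚ) / S - y0) && decide (bp = c - (I.lo : ℚ) / S - y0) && decide (-c ≤ y0 - h + (I.lo : ℚ) / S)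

/-- **The copy `y + L` on a switch panel**: with `β = c − L − y₀`, `b⁻ ≤ β ≤ b⁺`, the membership of `y₀ + ρ + L` is `true` on
`(-h, β)` and `false` on `(β, h)`. -/
theorem dt_switchPlus_sound {S : ℕ} (hS : 0 < S) {c h y0 : ℚ} {I : MI} {bm bp : ℚ}
    (hchk : dt_switchPlusCheck S c h y0 I bm bp = true) {L : ℝ} (hL : MI.mem S L I) :
    ((bm : ℝ) ≤ (c : ℝ) - L - y0 ∧ (c : ℝ) - L - y0 ≤ bp) ∧
    (∀ ρ : ℝ, -(h : ℝ) < ρ → ρ < (c : ℝ) - L - y0 → (true = true ↔ ((y0 : ℝ) + ρ) + L ∈ Icc (-(c : ℝ)) c)) ∧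
    (∀ ρ : ℝ, (c : ℝ) - L - y0 < ρ → ρ < h → (false = true ↔ ((y0 : ℝ) + ρ) + L ∈ Icc (-(c : ℝ)) c)) := by
  unfold dt_switchPlusCheck at hchk
  simp only [Bool.and_eq_true, decide_eq_true_eq] at hchk
  obtain ⟨⟨hbm, hbp⟩, hside⟩ := hchk
  obtain ⟨h1, h2⟩ := MI_mem_bounds hS hL
  have hside' : -(c : ℝ) ≤ (y0 : ℝ) - h + (((I.lo : ℚ) / S : ℚ) : ℝ) := by exact_mod_cast hside
  push_cast at h1 h2 hside'
  refine ⟨⟨?_, ?_⟩, fun ρ hρ1 hρ2 ↦ ⟨fun _ ↦ ⟨by linarith, by linarith⟩, fun _ ↦ rfl⟩,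
    fun ρ hρ1 _ ↦ ⟨fun h' ↦ Bool.noConfusion h', fun hm ↦ ?_⟩⟩
  · rw [hbm]; push_cast; linarith
  · rw [hbp]; push_cast; linarith
  · exfalso; linarith [hm.2]

/-- The rational bracket `[I⁻/S − c − y₀, I⁺/S − c − y₀]` of the switch point `β = L − c − y₀` of the copy `y − L`, and the side
condition `y₀ + h − I⁻/S ≤ c`. -/
def dt_switchMinusCheck (S : ℕ) (c h y0 : ℚ) (I : MI) (bm bp : ℚ) : Bool :=
  decide (bm = (I.lo : ℚ) / S - c - y0) && decide (bp = (I.hi : ℚ) / S - c - y0) && decide (y0 + h - (I.lo : ℚ) / S ≤ c)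

/-- **The copy `y − L` on a switch panel**: with `β = L − c − y₀`, `b⁻ ≤ β ≤ b⁺`, the membership of `y₀ + ρ − L` is `false` on
`(-h, β)` and `true` on `(β, h)`. -/
theorem dt_switchMinus_sound {S : ℕ} (hS : 0 < S) {c h y0 : ℚ} {I : MI} {bm bp : ℚ}
    (hchk : dt_switchMinusCheck S c h y0 I bm bp = true) {L : ℝ} (hL : MI.mem S L I) :
    ((bm : ℝ) ≤ L - c - y0 ∧ L - c - y0 ≤ bp) ∧
    (∀ ρ : ℝ, -(h : ℝ) < ρ → ρ < L - c - y0 → (false = true ↔ ((y0 : ℝ) + ρ) - L ∈ Icc (-(c : ℝ)) c)) ∧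
    (∀ ρ : ℝ, L - c - y0 < ρ → ρ < h → (true = true ↔ ((y0 : ℝ) + ρ) - L ∈ Icc (-(c : ℝ)) c)) := by
  unfold dt_switchMinusCheck at hchk
  simp only [Bool.and_eq_true, decide_eq_true_eq] at hchk
  obtain ⟨⟨hbm, hbp⟩, hside⟩ := hchk
  obtain ⟨h1, h2⟩ := MI_mem_bounds hS hL
  have hside' : (y0 : ℝ) + h - (((I.lo : ℚ) / S : ℚ) : ℝ) ≤ c := by exact_mod_cast hside
  push_cast at h1 h2 hside'
  refine ⟨⟨?_, ?_⟩, fun ρ _ hρ2 ↦ ⟨fun h' ↦ Bool.noConfusion h', fun hm ↦ ?_⟩,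
    fun ρ hρ1 hρ2 ↦ ⟨fun _ ↦ ⟨by linarith, by linarith⟩, fun _ ↦ rfl⟩⟩
  · rw [hbm]; push_cast; linarith
  · rw [hbp]; push_cast; linarith
  · exfalso; linarith [hm.1]

end Summit.RiemannHypothesis.RiemannHypothesis.Theorems.EvenWinsBeyondArch

end
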